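import Summits.BirchSwinnertonDyer.BirchSwinnertonDyer.Theorems.GoldfeldAllTwistsTwoConverseTwinEvenTwistDescentPOneAlpha
import Summits.BirchSwinnertonDyer.BirchSwinnertonDyer.Theorems.GoldfeldAllTwistsTwoConverseTwinQuarterTracePartnerQHeight
import Summits.BirchSwinnertonDyer.BirchSwinnertonDyer.Theorems.GoldfeldAllTwistsTwoConverseTwinEvenTwistLocalPOne
import HarnessLib

set_option linter.dupNamespace false -- namespace `…BirchSwinnertonDyer.BirchSwinnertonDyer…` is the cell's (D-0017 nested layout)
set_option autoImplicit false

/-!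
# Cell C7A partner `49a1^{(2p)}` at `p ≡ 1 (mod 8)`, type α, file D2-even: **`ord₂ L^{alg}(49a1^{(2p)}, 1) = 3`** (`L(W′,1) = q·Ω_∞(W′)`, `q ≠ 0`,
# `ord₂ q = 3`), the rank-`0` BSD package, and the `√(8p)`-period form — the χ_q package input (`m` odd) on C7A; LINE C3 file 2 twinned

Cell `bsd-goldfeld`, seat `bsd-goldfeld-s1p-c3x` (gen 13); planner RULING (ccclx) «OBJECT C7A BY THE χ_Z CHANNEL», tranche T4, file D2-even (memo
`HOME/C7A-CHIZ-CHANNEL.md` §2: the second ESSENTIAL `p ≡ 5 (8)` input of the α cone, re-proved at `p ≡ 1 (8)`). `--supports stmt-BirchSwinnertonDyer-20044`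
as a HELPER. Theses-free; theorems only; no definition, no new fact, no `sorry`. BINDERS BY NAME (standing allow-list): `hBT`, `hBF`, `hnew`.
FRONTIER-grade: a twist-density-ZERO sub-family modulo named print; never distance-to-summit.

THE ARGUMENT = LINE C3 file 2 (`…TwinEvenTwistLValue`, `p ≡ 5 (8)`) and `lValue_twoPosTwist_mul_sqrt` (`…TwinQuarterTracePartnerQHeight`) VERBATIM on D1-even
(`rank = 0 ∧ Ш[2] = 0 ∧ corank 0` for type α at `p ≡ 1 (8)`): `hBT` ⇒ `r_an = 0`; `hBF` ⇒ `L(1)/Ω = #Ш·Tam/#tors²` with `#Ш` odd, `#tors = 2`, `Tam = 32`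
(`tamagawaProduct_eq_thirtytwo_twoPosTwist`, `p ≡ 1 (4)`-generic) ⇒ `q = 8#Ш`, `ord₂ q = 3` — `49a1^{(2p)}` is `2`-MINIMAL on the α sibling of C7 (even-twist law:
`2`-minimal iff `¬(β ∧ p ≡ 1 (8))`; kit j317613: `r_an = 0`, ellrank `[0,0,0]` on 47/47 C7A rows).
HONEST FRAMING: one partner `L`-value modulo named print; items 19140 / 20044 unchanged; BSD is not proved by any of this.

References: [BurungaleFlach2024] Thm 1.1, Cor. 2; [BurungaleTian2026] Thm 1.1; [CoatesLiTianZhai2015] Prop. 5.9, Thm 4.4 (shape); [Pal2012] Thm 3.2.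
-/

noncomputable section

open scoped Classical

open scoped Classical

open WeierstrassCurve Literature.NumberTheory.EllipticCurves Literature.NumberTheory.EllipticCurves.ModularForms
  Literature.NumberTheory.EllipticCurves.Rank1Residual Summit.BirchSwinnertonDyer.Rank1Residual.P2

namespace Summit.BirchSwinnertonDyer.BirchSwinnertonDyer.Theorems.GoldfeldGoodTwists

variable {p : ℕ} [Fact p.Prime]

/-! ## §1 `#Ш` odd, analytic rank `0`, the `L`-value law at type α, `p ≡ 1 (mod 8)` -/

/-- `ord₂ #Ш(W') = 0` for every model of `49a1^{(2p)}` with finite `Ш` (`Ш[2] = 0`, C3-1b). [cite: SilvermanAEC2009, Thm. X.4.2(a)] -/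
theorem padicValNat_two_shaOrder_twoPosTwist_pOneAlpha (hp8 : p % 8 = 1) (hp7 : legendreSym p (-7) = 1) (hα : ¬ ∃ x : ZMod p, x ^ 4 = -7)
    (W' : WeierstrassCurve ℚ) [W'.IsElliptic] (C : VariableChange ℚ)
    (hC : C • W' = cm7.quadraticTwist ((2 * (p : ℤ) : ℤ) : ℚ)) [Finite W'.sha] : padicValNat 2 W'.shaOrder = 0 := by
  haveI : Fact (Nat.Prime 2) := ⟨Nat.prime_two⟩
  have h2 := (rank_eq_zero_and_sha_two_twoPosTwist_pOneAlpha hp8 hp7 hα W' C hC).2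
  have hbot := W'.primaryComponent_sha_eq_bot_of_forall h2
  have hcard : Nat.card (AddCommGroup.primaryComponent W'.sha 2) = 1 := by rw [hbot]; exact AddSubgroup.card_bot
  rw [WeierstrassCurve.shaOrder, ← padicValNat_card_addPrimaryComponent (A := W'.sha) 2, hcard, padicValNat_one_right]

/-! ## §2 Analytic rank `0` and the `L`-value law -/

/-- **`L(49a1^{(2p)}, 1) ≠ 0`** (analytic rank `0`) for every model `W` of `49a1^{(2p)}`, type-α `p ≡ 1 (mod 8)` prime split in
`ℚ(√−7)`, granted Burungale–Tian's rank-zero `2`-converse (`corank₂ Sel_{2^∞}(W) = 0` is D1-even's UNCONDITIONAL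
`selmerCorank_two_eq_zero_twoPosTwist_pOneAlpha`). [cite: BurungaleTian2026, Thm. 1.1] -/
theorem analyticRank_eq_zero_twoPosTwist_pOneAlpha
    (hBT : burungaleTian_analyticRank_eq_zero_of_selmerCorank_eq_zero_of_hasCM)
    (hp8 : p % 8 = 1) (hp7 : legendreSym p (-7) = 1) (hα : ¬ ∃ x : ZMod p, x ^ 4 = -7) (W : WeierstrassCurve ℚ) [W.IsElliptic]
    (C : VariableChange ℚ) (hC : C • W = cm7.quadraticTwist ((2 * (p : ℤ) : ℤ) : ℚ)) : W.analyticRank = 0 := by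
  have hp : p.Prime := Fact.out
  exact analyticRank_eq_zero_of_rank_eq_zero_of_sha_two hBT W
    (minimalModel_quadraticTwist_cm7 (mul_ne_zero two_ne_zero (by exact_mod_cast hp.ne_zero)) W C hC).2.1
    (rank_eq_zero_and_sha_two_twoPosTwist_pOneAlpha hp8 hp7 hα W C hC)

/-- **THE EVEN-PARTNER `L`-VALUE: `ord₂ L^{alg}(49a1^{(2p)}, 1) = 3`.** For a type-α prime `p ≡ 1 (mod 8)` with `(−7/p) = +1`
and every GLOBALLY MINIMAL model `W'` of `49a1^{(2p)}`: `L(W',1) = q·Ω_∞(W')` with `q ≠ 0` and `ord₂ q = 3` — granted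
Burungale–Tian (`hBT`), Burungale–Flach (`hBF`: `L(1)/Ω = #Ш·Tam/#tors²`) and modularity (`hnew`); with `#Ш` odd (D1-even),
`#tors = 2`, `Tam = 32`, so `q = 8·#Ш`. The even companion of CLTZ 2015 Prop. 5.9 / of c301's
`exists_LAlg_posTwist_of_symbol_neg`. [cite: BurungaleFlach2024, Thm. 1.1 and Cor. 2] [cite: BurungaleTian2026, Thm. 1.1]
[cite: CoatesLiTianZhai2015, Prop. 5.9 and Thm. 4.4 (shape)] -/
theorem exists_LAlg_twoPosTwist_pOneAlpha
    (hBT : burungaleTian_analyticRank_eq_zero_of_selmerCorank_eq_zero_of_hasCM)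
    (hBF : bsdTriple_of_hasCM_of_L_one_ne_zero) (hnew : exists_isNewformOf)
    (hp8 : p % 8 = 1) (hp7 : legendreSym p (-7) = 1) (hα : ¬ ∃ x : ZMod p, x ^ 4 = -7)
    (W' : WeierstrassCurve ℚ) [W'.IsElliptic] [W'.IsGloballyMinimal]
    (hC : ∃ C : VariableChange ℚ, C • W' = cm7.quadraticTwist ((2 * (p : ℤ) : ℤ) : ℚ)) :
    ∃ q : ℚ, W'.entireLFunction 1 = ((q * CoatesLiTianZhai2015.leastRealPeriod W' : ℝ) : ℂ) ∧ q ≠ 0 ∧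
      padicValRat 2 q = 3 := by
  have hp : p.Prime := Fact.out
  obtain ⟨hp2, -, hp7ne, hp4⟩ := aux_of_mod_eight_one hp8
  obtain ⟨C, hC⟩ := hC
  have hd0 : (2 * (p : ℤ) : ℤ) ≠ 0 := mul_ne_zero two_ne_zero (by exact_mod_cast hp.ne_zero)
  have hdQ : (((2 * (p : ℤ) : ℤ)) : ℚ) ≠ 0 := by exact_mod_cast hd0
  have hmod : hasEntireLFunction_rat := hasEntireLFunction_rat_of_exists_isNewformOf hnew
  haveI : Fact (Nat.Prime 2) := ⟨Nat.prime_two⟩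
  ------------------------------------------------------------------ `r_an = 0`, `L(1) ≠ 0`, CM, `j`
  have hr0 : W'.analyticRank = 0 := analyticRank_eq_zero_twoPosTwist_pOneAlpha hBT hp8 hp7 hα W' C hC
  have hL : W'.entireLFunction 1 ≠ 0 := (W'.analyticRank_eq_zero_iff_holds (hmod W')).mp hr0
  obtain ⟨hj, hcm, -⟩ := minimalModel_quadraticTwist_cm7 hd0 W' C hC
  ------------------------------------------------------------------ Burungale–Flach: `L(1)/Ω = #Ш·Tam/#W'(ℚ)²`
  obtain ⟨hfinpt, hfin, hq⟩ := twin_centralValue_eq_of_hasCM hBF hmod W' hcm hL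
  haveI := hfinpt; haveI := hfin
  ------------------------------------------------------------------ the three arithmetic factors
  have hjac : jacobiSym p 7 = 1 := by rw [← legendreSym_neg_seven_eq_jacobiSym hp2]; exact hp7
  have htam : W'.tamagawaProduct = 32 := tamagawaProduct_eq_thirtytwo_twoPosTwist hp2 hp7ne hjac W' C hC
  have hcard : Nat.card W'.toAffine.Point = 2 := by
    rw [← torsionOrder_eq_natCard_of_finite]; exact torsionOrder_eq_two_of_j_eq W' (Or.inl hj)
  have hsha : padicValNat 2 W'.shaOrder = 0 := padicValNat_two_shaOrder_twoPosTwist_pOneAlpha hp8 hp7 hα W' C hC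
  have hS0 : W'.shaOrder ≠ 0 := (Nat.card_pos (α := W'.sha)).ne'
  ------------------------------------------------------------------ the witness `q = twinQuotient W' = 8·#Ш`
  have hΩ : CoatesLiTianZhai2015.leastRealPeriod W' = W'.realPeriodRat :=
    leastRealPeriod_eq_realPeriodRat_of_smul_eq_cm7_quadraticTwist W' hdQ ⟨C, hC⟩
  have hΩ0 : (W'.realPeriodRat : ℂ) ≠ 0 := by exact_mod_cast (W'.realPeriodRat_pos_holds).ne'
  have htq : twinQuotient W' = 8 * (W'.shaOrder : ℚ) := by
    unfold twinQuotient; rw [htam, hcard]; push_cast; ring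
  refine ⟨twinQuotient W', ?_, ?_, ?_⟩
  · rw [hΩ]; push_cast
    rw [← hq]; field_simp
  · rw [htq]; exact mul_ne_zero (by norm_num) (by exact_mod_cast hS0)
  · have h8 : padicValRat 2 (8 : ℚ) = 3 := by
      rw [show (8 : ℚ) = ((8 : ℕ) : ℚ) by norm_num, padicValRat.of_nat]
      norm_cast
      rw [show (8 : ℕ) = 2 ^ 3 by norm_num, padicValNat.prime_pow]
    rw [htq, padicValRat.mul (by norm_num) (by exact_mod_cast hS0), padicValRat.of_nat, hsha, h8]
    norm_num

/-- **Consequences in one place** (for the PHASE-2 partner file `χ_q`): for every globally minimal `W' ≅ 49a1^{(2p)}`, type-α `p ≡ 1 (mod 8)`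
split — `r_an(W') = 0`, `L(W',1) ≠ 0`, the full BSD triple holds (Burungale–Flach), `#Ш(W')` is finite and ODD, `#W'(ℚ) = 2`,
`Tam(W') = 32`. [cite: BurungaleFlach2024, Thm. 1.1 and Cor. 2] [cite: BurungaleTian2026, Thm. 1.1] -/
theorem rankZero_bsdTriple_twoPosTwist_pOneAlpha
    (hBT : burungaleTian_analyticRank_eq_zero_of_selmerCorank_eq_zero_of_hasCM)
    (hBF : bsdTriple_of_hasCM_of_L_one_ne_zero) (hnew : exists_isNewformOf)
    (hp8 : p % 8 = 1) (hp7 : legendreSym p (-7) = 1) (hα : ¬ ∃ x : ZMod p, x ^ 4 = -7)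
    (W' : WeierstrassCurve ℚ) [W'.IsElliptic] [W'.IsGloballyMinimal]
    (hC : ∃ C : VariableChange ℚ, C • W' = cm7.quadraticTwist ((2 * (p : ℤ) : ℤ) : ℚ)) :
    W'.analyticRank = 0 ∧ W'.entireLFunction 1 ≠ 0 ∧ W'.BSDTriple ∧ W'.ShaFinite ∧ Odd W'.shaOrder ∧
      W'.tamagawaProduct = 32 := by
  have hp : p.Prime := Fact.out
  obtain ⟨hp2, -, hp7ne, -⟩ := aux_of_mod_eight_one hp8
  obtain ⟨C, hC⟩ := hC
  have hd0 : (2 * (p : ℤ) : ℤ) ≠ 0 := mul_ne_zero two_ne_zero (by exact_mod_cast hp.ne_zero)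
  have hmod : hasEntireLFunction_rat := hasEntireLFunction_rat_of_exists_isNewformOf hnew
  have hr0 : W'.analyticRank = 0 := analyticRank_eq_zero_twoPosTwist_pOneAlpha hBT hp8 hp7 hα W' C hC
  have hL : W'.entireLFunction 1 ≠ 0 := (W'.analyticRank_eq_zero_iff_holds (hmod W')).mp hr0
  obtain ⟨_, hcm, -⟩ := minimalModel_quadraticTwist_cm7 hd0 W' C hC
  obtain ⟨hrank, hfin, hlead⟩ := hBF W' hcm hL
  have hjac : jacobiSym p 7 = 1 := by rw [← legendreSym_neg_seven_eq_jacobiSym hp2]; exact hp7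
  refine ⟨hr0, hL, ⟨hrank, hfin, hlead⟩, hfin, ?_, tamagawaProduct_eq_thirtytwo_twoPosTwist hp2 hp7ne hjac W' C hC⟩
  haveI : Finite W'.sha := hfin
  exact odd_natCard_of_forall_two_nsmul fun c hc ↦
    Subtype.ext ((rank_eq_zero_and_sha_two_twoPosTwist_pOneAlpha hp8 hp7 hα W' C hC).2 c c.2
      (by exact_mod_cast congrArg Subtype.val hc))

/-! ## §2 The `√(8p)`-period form (χ_q package input) -/

/-- **`L(W₂, 1)·√(8p) = r₂·Ω(X₀(49))`, `ord₂ r₂ = 3`, `r₂ ≠ 0`**, for every globally minimal `W₂ ≅ 49a1^{(2p)}`, `p ≡ 5 (mod 8)`, `(−7/p) = +1`: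
LINE C3's `exists_LAlg_twoPosTwist` (`L(W₂,1) = r₂·Ω_∞(W₂)`, granted `hBT`, `hBF`, `hnew`), `Ω_∞ = Ω` (one real component) and the
period law above. (A″'s `lValue_twoTorsionModel_two_mul_sqrt_eight` is the `49a1^{(2)}` twin, `ord₂ = 1`.) [cite: BurungaleFlach2024, Thm. 1.1]
[cite: BurungaleTian2026, Thm. 1.1] [cite: Pal2012, Thm. 3.2] -/
theorem lValue_twoPosTwist_mul_sqrt_pOneAlpha (hBT : burungaleTian_analyticRank_eq_zero_of_selmerCorank_eq_zero_of_hasCM)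
    (hBF : bsdTriple_of_hasCM_of_L_one_ne_zero) (hnew : exists_isNewformOf) (hp8 : p % 8 = 1) (hp7 : legendreSym p (-7) = 1) (hα : ¬ ∃ x : ZMod p, x ^ 4 = -7)
    (W₂ : WeierstrassCurve ℚ) [W₂.IsElliptic] [W₂.IsGloballyMinimal]
    (hC : ∃ C : VariableChange ℚ, C • W₂ = cm7.quadraticTwist ((2 * (p : ℤ) : ℤ) : ℚ)) :
    ∃ r : ℚ, padicValRat 2 r = 3 ∧ r ≠ 0 ∧
      W₂.entireLFunction 1 * (Real.sqrt (8 * p) : ℂ) = ((r : ℝ) * cm7.realPeriodRat : ℝ) := by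
  have hp : p.Prime := Fact.out
  obtain ⟨hp2, -, -, -⟩ := aux_of_mod_eight_one hp8
  have hdQ : (((2 * (p : ℤ) : ℤ)) : ℚ) ≠ 0 := by
    push_cast; exact mul_ne_zero two_ne_zero (by exact_mod_cast hp.ne_zero)
  obtain ⟨r, hL, hr0, hv⟩ := exists_LAlg_twoPosTwist_pOneAlpha hBT hBF hnew hp8 hp7 hα W₂ hC
  refine ⟨r, hv, hr0, ?_⟩
  rw [hL, leastRealPeriod_eq_realPeriodRat_of_smul_eq_cm7_quadraticTwist W₂ hdQ hC,
    ← realPeriodRat_mul_sqrt_eight_mul_of_smul_eq_cm7_quadraticTwist_twoPos hp2 W₂ hC]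
  push_cast
  ring

end Summit.BirchSwinnertonDyer.BirchSwinnertonDyer.Theorems.GoldfeldGoodTwists
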